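import Summits.ResolutionOfSingularities.ResolutionOfSingularities.Theorems.FrobeniusClosingPatchingRelPerfectCoreRungTowerWeakTransform
import Summits.ResolutionOfSingularities.ResolutionOfSingularities.Theorems.FrobeniusClosingPatchingRelPerfectCoreRungGraphQuotient
import HarnessLib

/-!
# Crux `PatchingRelPerfect` (stmt-ResolutionOfSingularities-16161), chain w52 — CORE RUNG r1τ,
# part 4: HYPERSURFACE thickenings `(q) + 𝔪^{d+e+1}`, `(q) + (x₁ᵃ, …, x_nᵃ)`, and the quadric
# member `(x₀ᵃ, …, x₃ᵃ, x₀x₁ + x₂x₃)` for EVERY `a ≥ 3`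

[OURS · L1 W5.2 · rung r1τ] User-facing form of the weak-transform tower
(`…CoreRungTowerWeakTransform.lean`) for ONE equation `q` of order `d`: on each Rees chart `B_i`
of `Bl_𝔪 Spec S` a weak transform `Q_i` (`q = x_iᵈ Q_i`) with `Q_i ∉ x_i B_i` (the initial form
of `q` does not vanish on the chart) and `B_i/(x_i, Q_i)` a regular ring (the projective tangent
cone `V(q̄) ⊆ E ≅ ℙ^{n-1}_κ` is regular on the chart).  The weak regularity of `(x_i, Q_i)` needed
by the tower is automatic, `B_i/(x_i) ≅ κ[T_j : j ≠ i]` being a domain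
(`CoreRungTower.isWeaklyRegular_pair_of_notMem`, `isDomain_chartRing_quot_span`).  PROVED, for
every regular local `S` of every dimension and every `e`:

* `companion_hypersurface_sup_pow`, `coreRung_hypersurface_sup_pow` — `(q) + 𝔪^{d+e+1} ∈ 𝒞` and
  the blow-up-form core's conclusion for its blowing ups;
* `companion_hypersurface_frobeniusMember`, `coreRung_hypersurface_frobeniusMember` — the same for
  `(q) + (x₁ᵃ, …, x_nᵃ)`, `a = d + e + 1` (the K5.2b hunt shape `(x_iᵖ) + (q)`, `ord q < p`,
  smooth tangent cone: FOUND for EVERY `p`);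
* `coreRung_powersQuadric` (+ binder shape `atomDimFourBlowupAt_powersQuadric`) — the hunt member
  `q = x₀x₁ + x₂x₃` in a regular local ring with minimal basis `x` of length `4`:
  `(x₀ᵃ, x₁ᵃ, x₂ᵃ, x₃ᵃ, x₀x₁ + x₂x₃) ∈ 𝒞` for EVERY `a ≥ 3` (stub-4's r1e
  `coreRung_cubesQuadric` is `a = 3`, companion `𝔪`; for `a ≥ 4` the companion is the tower
  `𝔪 · ∏_{k<a-3} ((q) + 𝔪^{3+k})` times `((q) + 𝔪ᵃ)⁴`), the chart regularity being stub-4's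
  `isRegularRing_chartRing_quot_graph`.

FORMAT evidence for the core (CHAIN §1 (A)).  Nothing here is a statement of the manuscript under
review.

## References

* Q. Liu, *Algebraic Geometry and Arithmetic Curves*, OUP 2002, Thm. 8.1.19 (a). [Liu2002]
* The Stacks Project, Tags 080A, 080B, 0804, 0BIQ. [StacksProject]
-/

-- `Summit.<Summit>.<Sub>.Theorems` with `Sub = Summit` (single-conjunct summit, D-0017)
set_option linter.dupNamespace false

noncomputable section

open CategoryTheory CategoryTheory.Limits AlgebraicGeometry Literature.AlgebraicGeometry.Resolution
open scoped Pointwise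

namespace Summit.ResolutionOfSingularities.ResolutionOfSingularities.Theorems

universe u

/-! ## Pairs `(t, u)` with `u` non-zero modulo a prime element `t` -/

/-- **`(t, u)` is a weakly regular sequence** when `t` is a non-zero-divisor, `A/(t)` is a domain
and `u ∉ (t)`. [folklore] -/
theorem CoreRungTower.isWeaklyRegular_pair_of_notMem {A : Type u} [CommRing A] {t u : A}
    (ht : t ∈ nonZeroDivisors A) [IsDomain (A ⧸ Ideal.span {t})] (hu : u ∉ Ideal.span {t}) :
    RingTheory.Sequence.IsWeaklyRegular A (List.ofFn (Fin.cons t fun _ : Fin 1 => u)) := by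
  rw [List.ofFn_succ, Fin.cons_zero, RingTheory.Sequence.isWeaklyRegular_cons_iff]
  simp only [Fin.cons_succ, List.ofFn_succ, List.ofFn_zero]
  refine ⟨Module.Flat.isSMulRegular_of_nonZeroDivisors ht, ?_⟩
  rw [RingTheory.Sequence.isWeaklyRegular_singleton_iff]
  have hKsm : (t • ⊤ : Submodule A A) = Ideal.span {t} := by
    rw [← Submodule.ideal_span_singleton_smul, smul_eq_mul, Ideal.mul_top]
  rw [(Submodule.quotEquivOfEq _ _ hKsm).isSMulRegular_congr]
  have hu0 : Ideal.Quotient.mk (Ideal.span {t}) u ≠ 0 :=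
    fun h => hu (Ideal.Quotient.eq_zero_iff_mem.mp h)
  intro a b hab
  obtain ⟨a, rfl⟩ := Ideal.Quotient.mk_surjective a
  obtain ⟨b, rfl⟩ := Ideal.Quotient.mk_surjective b
  have hab' : Ideal.Quotient.mk (Ideal.span {t}) (u * a) =
      Ideal.Quotient.mk (Ideal.span {t}) (u * b) := hab
  rw [map_mul, map_mul] at hab'
  exact mul_left_cancel₀ hu0 hab'

/-- **The Rees chart modulo the exceptional parameter is a domain**: for `x` quasi-regular with
`R/(x)` a domain, `B_i/(x_i) ≅ (R/(x))[T_j : j ≠ i]` (`chartQuotEquiv`).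
[cite: StacksProject, Tag 0BIQ] -/
theorem isDomain_chartRing_quot_span {R : Type u} [CommRing R] {n : ℕ} (x : Fin n → R)
    (i : Fin n) (hx : IsQuasiRegular x) [IsDomain (R ⧸ Ideal.span (Set.range x))] :
    IsDomain (chartRing x i ⧸ Ideal.span {chartBase x i (x i)}) :=
  MulEquiv.isDomain (MvPolynomial {j : Fin n // j ≠ i} (R ⧸ Ideal.span (Set.range x)))
    (chartQuotEquiv x i hx).symm.toMulEquiv

/-! ## Hypersurface thickenings -/

section Hypersurface

variable {S : Type u} [CommRing S] [IsRegularLocalRing S] {n : ℕ} (x : Fin n → S)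
  (hx : Ideal.span (Set.range x) = IsLocalRing.maximalIdeal S)
  (hd : (IsLocalRing.maximalIdeal S).spanFinrank = n)
  (q : S) (d : ℕ) (Q : ∀ i : Fin n, chartRing x i)
  (hQ : ∀ i, chartBase x i q = chartBase x i (x i) ^ d * Q i)
  (hnot : ∀ i, Q i ∉ Ideal.span {chartBase x i (x i)})
  (hreg : ∀ i, IsRegularRing (chartRing x i ⧸ Ideal.span {chartBase x i (x i), Q i}))

include hx hd hnot in
/-- The chart pair `(x_i, Q_i)` is weakly regular. [folklore] -/
theorem CoreRungTower.isWeaklyRegular_chartPair (i : Fin n) :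
    RingTheory.Sequence.IsWeaklyRegular (chartRing x i)
      (List.ofFn (Fin.cons (chartBase x i (x i)) fun _ : Fin 1 => Q i)) := by
  haveI : (Ideal.span (Set.range x)).IsMaximal := hx ▸ IsLocalRing.maximalIdeal.isMaximal S
  letI := Ideal.Quotient.field (Ideal.span (Set.range x))
  haveI := isDomain_chartRing_quot_span x i (isQuasiRegular_regularSystemOfParameters hd x hx)
  exact CoreRungTower.isWeaklyRegular_pair_of_notMem
    (reesChartBase_mem_nonZeroDivisors (x i) (Ideal.mem_span_range_self (f := x) (x := i)))
    (hnot i)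

include hreg in
omit [IsRegularLocalRing S] in
/-- The chart quotient in the weak-transform tower's format. [folklore] -/
theorem CoreRungTower.isRegularRing_quot_chartPair (i : Fin n) :
    IsRegularRing (chartRing x i ⧸
      Ideal.span (Set.range (Fin.cons (chartBase x i (x i)) fun _ : Fin 1 => Q i))) := by
  have h : Ideal.span (Set.range (Fin.cons (chartBase x i (x i)) fun _ : Fin 1 => Q i)) =
      Ideal.span {chartBase x i (x i), Q i} := by
    rw [Fin.range_cons, Set.range_const]
  haveI := hreg i
  exact IsRegularRing.of_ringEquiv (Ideal.quotEquivOfEq h).symm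

include hx hd hQ hnot hreg in
/-- **`(q) + 𝔪^{d+e+1}` is in the companion class** when `q = x_iᵈ Q_i` on every chart with
`Q_i ∉ x_i B_i` and `B_i/(x_i, Q_i)` regular: companion `𝔪 · ∏_{k<e} ((q) + 𝔪^{d+k+1})`, model
the weak-transform tower. [cite: Liu2002, Thm. 8.1.19 (a)] [cite: StacksProject, Tag 080A] -/
theorem companion_hypersurface_sup_pow (e : ℕ) :
    ∃ (P : Ideal S) (m' : ℕ), IsLocalRing.maximalIdeal S ^ m' ≤ P ∧
      ∃ (B : Scheme.{u}) (b : B ⟶ Spec (.of S)),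
        IsBlowup b (affineBlowup.idealSheaf
          ((Ideal.span {q} ⊔ IsLocalRing.maximalIdeal S ^ (d + e + 1)) * P)) ∧
        Scheme.IsRegular B := by
  have h := companion_span_sup_pow_weakTransform x hx hd (fun _ : Fin 1 => q) d
    (fun i _ => Q i) (fun i _ => hQ i)
    (fun i => CoreRungTower.isWeaklyRegular_chartPair x hx hd Q hnot i)
    (fun i => CoreRungTower.isRegularRing_quot_chartPair x Q hreg i) e
  rwa [Set.range_const] at h

include hx hd hQ hnot hreg in
/-- **CORE RUNG r1τ — hypersurface thickenings.** Every blowing up `f : T ⟶ Spec S` along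
`(q) + 𝔪^{d+e+1} ≠ 0` satisfies the conclusion of the blow-up-form open core `AtomDimFourBlowupAt`,
for `q` with chartwise weak transforms `Q_i ∉ x_i B_i`, `B_i/(x_i, Q_i)` regular.  Every `e`,
every dimension. [cite: Liu2002, Thm. 8.1.19 (a)] [cite: StacksProject, Tag 080A] -/
theorem coreRung_hypersurface_sup_pow (e : ℕ)
    (hI : Ideal.span {q} ⊔ IsLocalRing.maximalIdeal S ^ (d + e + 1) ≠ ⊥) (T : Scheme.{u})
    (f : T ⟶ Spec (.of S))
    (hf : IsBlowup f (affineBlowup.idealSheaf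
      (Ideal.span {q} ⊔ IsLocalRing.maximalIdeal S ^ (d + e + 1)))) :
    ∃ (J : T.IdealSheafData) (T' : Scheme.{u}) (π : T' ⟶ T), J ≠ ⊥ ∧
      (∀ t : T, t ∈ J.support → f.base t = IsLocalRing.closedPoint S) ∧
      IsBlowup π J ∧ Scheme.IsRegular T' :=
  atomConclusion_of_companion' hI (companion_hypersurface_sup_pow x hx hd q d Q hQ hnot hreg e)
    T f hf

include hx hd hQ hnot hreg in
/-- **`(q) + (x₁ᵃ, …, x_nᵃ)`, `a = d + e + 1`, is in the companion class** under the same chart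
condition (sup-reduction of `(q) + 𝔪ᵃ`). [cite: StacksProject, Tag 080A] -/
theorem companion_hypersurface_frobeniusMember (e : ℕ) :
    ∃ (P : Ideal S) (m' : ℕ), IsLocalRing.maximalIdeal S ^ m' ≤ P ∧
      ∃ (B : Scheme.{u}) (b : B ⟶ Spec (.of S)),
        IsBlowup b (affineBlowup.idealSheaf
          ((Ideal.span {q} ⊔ Ideal.span (Set.range fun j => x j ^ (d + e + 1))) * P)) ∧
        Scheme.IsRegular B := by
  have h := companion_frobeniusMember_weakTransform x hx hd (fun _ : Fin 1 => q) d
    (fun i _ => Q i) (fun i _ => hQ i)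
    (fun i => CoreRungTower.isWeaklyRegular_chartPair x hx hd Q hnot i)
    (fun i => CoreRungTower.isRegularRing_quot_chartPair x Q hreg i) e
  rwa [Set.range_const] at h

include hx hd hQ hnot hreg in
/-- **CORE RUNG r1τ — hypersurface Frobenius members.** Every blowing up `f : T ⟶ Spec S` along
`I = (q) + (x₁ᵃ, …, x_nᵃ) ≠ 0`, `a = d + e + 1`, satisfies the conclusion of the blow-up-form
open core, for `q` with chartwise weak transforms `Q_i ∉ x_i B_i`, `B_i/(x_i, Q_i)` regular.
Every `e`, every dimension. [cite: StacksProject, Tag 080A] [cite: Liu2002, Thm. 8.1.19 (a)] -/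
theorem coreRung_hypersurface_frobeniusMember (e : ℕ)
    (hI : Ideal.span {q} ⊔ Ideal.span (Set.range fun j => x j ^ (d + e + 1)) ≠ ⊥)
    (T : Scheme.{u}) (f : T ⟶ Spec (.of S))
    (hf : IsBlowup f (affineBlowup.idealSheaf
      (Ideal.span {q} ⊔ Ideal.span (Set.range fun j => x j ^ (d + e + 1))))) :
    ∃ (J : T.IdealSheafData) (T' : Scheme.{u}) (π : T' ⟶ T), J ≠ ⊥ ∧
      (∀ t : T, t ∈ J.support → f.base t = IsLocalRing.closedPoint S) ∧
      IsBlowup π J ∧ Scheme.IsRegular T' :=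
  atomConclusion_of_companion' hI
    (companion_hypersurface_frobeniusMember x hx hd q d Q hQ hnot hreg e) T f hf

end Hypersurface

/-! ## The quadric member `(x₀ᵃ, …, x₃ᵃ, x₀x₁ + x₂x₃)`, every `a ≥ 3` -/

section Quadric

variable {S : Type u} [CommRing S] [IsRegularLocalRing S] (x : Fin 4 → S)
  (hx : Ideal.span (Set.range x) = IsLocalRing.maximalIdeal S)
  (hd : (IsLocalRing.maximalIdeal S).spanFinrank = 4)

omit [IsRegularLocalRing S] in
/-- The uniform weak transform `e₀e₁ + e₂e₃` of the quadric on the chart `D₊(x_i t)`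
(`e_i = 1`): `q = x_i² · (e₀e₁ + e₂e₃)`. [cite: StacksProject, Tag 0804] -/
theorem CoreRungTower.chartBase_quadric (i : Fin 4) :
    chartBase x i (x 0 * x 1 + x 2 * x 3) = chartBase x i (x i) ^ 2 *
      (chartGen x i 0 * chartGen x i 1 + chartGen x i 2 * chartGen x i 3) := by
  have hψ : ∀ j, chartBase x i (x j) = chartBase x i (x i) * chartGen x i j :=
    reesChartBase_apply_eq_mul_chartGen x i
  rw [map_add, map_mul, map_mul, hψ 0, hψ 1, hψ 2, hψ 3]
  ring

include hx hd in
/-- **Chart condition for the quadric**: with `{i, a, b, d} = {0, 1, 2, 3}` and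
`e₀e₁ + e₂e₃ = e_a + e_b e_d` on the chart (`e_i = 1`), the weak transform is not divisible by
`x_i` (`T_a + T_b T_d ≠ 0` in `κ[T]`) and `B_i/(x_i, e_a + e_b e_d)` is regular (stub-4's graph
quotient). [cite: StacksProject, Tag 0BIQ] -/
theorem CoreRungTower.quadric_chart (i a b d : Fin 4) (hia : i ≠ a) (hib : i ≠ b) (hid : i ≠ d)
    (hab : a ≠ b) (had : a ≠ d) (hbd : b ≠ d)
    (hall : ∀ j : Fin 4, j = i ∨ j = a ∨ j = b ∨ j = d)
    (he : chartGen x i 0 * chartGen x i 1 + chartGen x i 2 * chartGen x i 3 =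
      chartGen x i a + chartGen x i b * chartGen x i d) :
    chartGen x i 0 * chartGen x i 1 + chartGen x i 2 * chartGen x i 3 ∉
        Ideal.span {chartBase x i (x i)} ∧
      IsRegularRing (chartRing x i ⧸ Ideal.span {chartBase x i (x i),
        chartGen x i 0 * chartGen x i 1 + chartGen x i 2 * chartGen x i 3}) := by
  classical
  haveI : (Ideal.span (Set.range x)).IsMaximal := hx ▸ IsLocalRing.maximalIdeal.isMaximal S
  letI := Ideal.Quotient.field (Ideal.span (Set.range x))
  have hqr : IsQuasiRegular x := isQuasiRegular_regularSystemOfParameters hd x hx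
  have huniv : ∀ j : {j : Fin 4 // j ≠ i}, j = ⟨a, hia.symm⟩ ∨ j = ⟨b, hib.symm⟩ ∨
      j = ⟨d, hid.symm⟩ := by
    intro j
    rcases hall j.1 with h | h | h | h
    · exact absurd h j.2
    · exact Or.inl (Subtype.ext h)
    · exact Or.inr (Or.inl (Subtype.ext h))
    · exact Or.inr (Or.inr (Subtype.ext h))
  rw [he]
  refine ⟨fun hmem => ?_, ?_⟩
  · -- modulo `x_i` the weak transform is the non-zero polynomial `T_a + T_b T_d`
    set P : MvPolynomial {j : Fin 4 // j ≠ i} (S ⧸ Ideal.span (Set.range x)) :=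
      MvPolynomial.X ⟨a, hia.symm⟩ + MvPolynomial.X ⟨b, hib.symm⟩ * MvPolynomial.X ⟨d, hid.symm⟩
      with hP
    have hε : chartQuotEquiv x i hqr P = Ideal.Quotient.mk _
        (chartGen x i a + chartGen x i b * chartGen x i d) := by
      rw [hP, map_add, map_mul, chartQuotEquiv_apply, chartQuotEquiv_apply, chartQuotEquiv_apply,
        chartQuotMap_X, chartQuotMap_X, chartQuotMap_X, map_add, map_mul]
    have hP0 : P = 0 := (chartQuotEquiv x i hqr).injective
      (by rw [hε, map_zero]; exact Ideal.Quotient.eq_zero_iff_mem.mpr hmem)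
    have heval : MvPolynomial.eval (fun j : {j : Fin 4 // j ≠ i} =>
        if j = ⟨a, hia.symm⟩ then (1 : S ⧸ Ideal.span (Set.range x)) else 0) P = 1 := by
      rw [hP, map_add, map_mul, MvPolynomial.eval_X, MvPolynomial.eval_X, MvPolynomial.eval_X,
        if_pos rfl, if_neg (fun h => hab (congrArg Subtype.val h).symm)]
      ring
    rw [hP0, map_zero] at heval
    exact zero_ne_one heval
  · exact isRegularRing_chartRing_quot_graph x i ⟨a, hia.symm⟩ ⟨b, hib.symm⟩ ⟨d, hid.symm⟩ hqr
      (fun h => hab (congrArg Subtype.val h)) (fun h => had (congrArg Subtype.val h))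
      (fun h => hbd (congrArg Subtype.val h)) huniv

include hx hd in
/-- The chart condition on all four charts. [cite: StacksProject, Tag 0BIQ] -/
theorem CoreRungTower.quadric_charts (i : Fin 4) :
    chartGen x i 0 * chartGen x i 1 + chartGen x i 2 * chartGen x i 3 ∉
        Ideal.span {chartBase x i (x i)} ∧
      IsRegularRing (chartRing x i ⧸ Ideal.span {chartBase x i (x i),
        chartGen x i 0 * chartGen x i 1 + chartGen x i 2 * chartGen x i 3}) := by
  have hall : ∀ j : Fin 4, j = 0 ∨ j = 1 ∨ j = 2 ∨ j = 3 := by decide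
  fin_cases i
  · exact CoreRungTower.quadric_chart x hx hd 0 1 2 3 (by decide) (by decide) (by decide)
      (by decide) (by decide) (by decide) hall (by rw [show chartGen x 0 0 = 1 from chartGen_self x 0]; ring)
  · exact CoreRungTower.quadric_chart x hx hd 1 0 2 3 (by decide) (by decide) (by decide)
      (by decide) (by decide) (by decide) (fun j => by rcases hall j with h | h | h | h <;> simp [h])
      (by rw [show chartGen x 1 1 = 1 from chartGen_self x 1]; ring)
  · exact CoreRungTower.quadric_chart x hx hd 2 3 0 1 (by decide) (by decide) (by decide)
      (by decide) (by decide) (by decide) (fun j => by rcases hall j with h | h | h | h <;> simp [h])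
      (by rw [show chartGen x 2 2 = 1 from chartGen_self x 2]; ring)
  · exact CoreRungTower.quadric_chart x hx hd 3 2 0 1 (by decide) (by decide) (by decide)
      (by decide) (by decide) (by decide) (fun j => by rcases hall j with h | h | h | h <;> simp [h])
      (by rw [show chartGen x 3 3 = 1 from chartGen_self x 3]; ring)

include hx hd in
/-- **CORE RUNG r1τ — the quadric member for every exponent.** For `S` regular local with minimal
basis `x = (x₀, x₁, x₂, x₃)` of `𝔪` and every `a ≥ 3`, every blowing up `f : T ⟶ Spec S` along
`I = (x₀x₁ + x₂x₃) + (x₀ᵃ, x₁ᵃ, x₂ᵃ, x₃ᵃ)` satisfies the conclusion of the blow-up-form open core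
`AtomDimFourBlowupAt`: `I` is a sup-reduction of `(q) + 𝔪ᵃ`, whose companion is the weak-transform
tower `𝔪 ((q)+𝔪³) ⋯ ((q)+𝔪ᵃ⁻¹)` (point blow-up, then `a − 3` blowing ups of the regular
codimension-2 centres over the smooth quadric `E ∩ {strict transform of q}`, then that quadric
section).  `a = 3` is stub-4's r1e (`coreRung_cubesQuadric`, companion `𝔪`); the hunt member
`(x_iᵖ) + (x₀x₁ + x₂x₃)` is thus FOUND for every `p ≥ 3`. [cite: StacksProject, Tag 080A]
[cite: Liu2002, Thm. 8.1.19 (a)] -/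
theorem coreRung_powersQuadric (a : ℕ) (ha : 3 ≤ a) (T : Scheme.{u}) (f : T ⟶ Spec (.of S))
    (hf : IsBlowup f (affineBlowup.idealSheaf
      (Ideal.span {x 0 * x 1 + x 2 * x 3} ⊔ Ideal.span (Set.range fun j => x j ^ a)))) :
    ∃ (J : T.IdealSheafData) (T' : Scheme.{u}) (π : T' ⟶ T), J ≠ ⊥ ∧
      (∀ t : T, t ∈ J.support → f.base t = IsLocalRing.closedPoint S) ∧
      IsBlowup π J ∧ Scheme.IsRegular T' := by
  haveI : IsDomain S := isDomain_of_isRegularLocalRing S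
  have hx0 : x 0 ≠ 0 := (isRsopPart_comp_of_rsop hd x hx id Function.injective_id).ne_zero 0
  have hI : Ideal.span {x 0 * x 1 + x 2 * x 3} ⊔ Ideal.span (Set.range fun j => x j ^ a) ≠ ⊥ :=
    fun h => pow_ne_zero a hx0
      ((Submodule.eq_bot_iff _).mp h _ (Ideal.mem_sup_right (Ideal.subset_span ⟨0, rfl⟩)))
  obtain ⟨e, rfl⟩ : ∃ e, a = 2 + e + 1 := ⟨a - 3, by omega⟩
  exact coreRung_hypersurface_frobeniusMember x hx hd (x 0 * x 1 + x 2 * x 3) 2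
    (fun i => chartGen x i 0 * chartGen x i 1 + chartGen x i 2 * chartGen x i 3)
    (CoreRungTower.chartBase_quadric x) (fun i => (CoreRungTower.quadric_charts x hx hd i).1)
    (fun i => (CoreRungTower.quadric_charts x hx hd i).2) e hI T f hf

/-- **The registered core's binder shape, restricted to the quadric members** (hypotheses of
`stub_atomDimFourBlowup`; characteristic, completeness, residue field and the off-fibre
hypothesis unused; the dimension enters as the length `4` of the minimal basis).
[cite: StacksProject, Tag 080A] [cite: Liu2002, Thm. 8.1.19 (a)] -/
theorem atomDimFourBlowupAt_powersQuadric (p : ℕ) (_hp : p.Prime) (S : Type) [CommRing S]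
    [IsRegularLocalRing S] [CharP S p] [IsAdicComplete (IsLocalRing.maximalIdeal S) S]
    [PerfectField (IsLocalRing.ResidueField S)] (_hS : ringKrullDim S = (4 : ℕ))
    (x : Fin 4 → S) (hx : Ideal.span (Set.range x) = IsLocalRing.maximalIdeal S)
    (hd : (IsLocalRing.maximalIdeal S).spanFinrank = 4) (a : ℕ) (ha : 3 ≤ a)
    (T : Scheme.{0}) (f : T ⟶ Spec (.of S))
    (hf : IsBlowup f (affineBlowup.idealSheaf
      (Ideal.span {x 0 * x 1 + x 2 * x 3} ⊔ Ideal.span (Set.range fun j => x j ^ a))))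
    (_hoff : ∀ t : T, f.base t ≠ IsLocalRing.closedPoint S →
      IsRegularLocalRing (T.presheaf.stalk t)) :
    ∃ (J : T.IdealSheafData) (T' : Scheme.{0}) (π : T' ⟶ T), J ≠ ⊥ ∧
      (∀ t : T, t ∈ J.support → f.base t = IsLocalRing.closedPoint S) ∧
      IsBlowup π J ∧ Scheme.IsRegular T' :=
  coreRung_powersQuadric x hx hd a ha T f hf

end Quadric

end Summit.ResolutionOfSingularities.ResolutionOfSingularities.Theorems

end
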